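import Summits.BirchSwinnertonDyer.BirchSwinnertonDyer.Theorems.ResidualThetaTransportAtTwoResidualSignedLambdaLowerCMAtTwoRhoLayerPairingGlueAwayTwo
import Summits.BirchSwinnertonDyer.BirchSwinnertonDyer.Theorems.ResidualThetaTransportAtTwoResidualSignedLambdaLowerCMAtTwoCofreeSelmerTransfer
import Summits.BirchSwinnertonDyer.BirchSwinnertonDyer.Theorems.ResidualThetaTransportAtTwoResidualSignedLambdaLowerCMAtTwoRhoLayerPairingCompat
import HarnessLib

/-!
# S4₀'s test classes in the frame: the transferred class `τ_{n,k} b ∈ H¹(Γ_∞, A_ρ)` of a layer class `b ∈ H¹(Γ_n, A_ρ[2^k])` read through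
# `locKer` / `locAway` — `loc_w(τ b) = j_{n,k}(loc_n b)`, `locAway (τ b) w c = j_{n,k}(loc_n(σ_c · b))`, and `loc_v(τ b) = 0` from `awayKer`

Route `ResidualThetaTransportAtTwo` (RTT), crux RSL_g `ResidualSignedLambdaLowerCMAtTwo` (stmt-BirchSwinnertonDyer-22608); seat
`prover-bsd-wall-tp2-p2x` g19 (`--supports 22608 --as helper`, closes nothing). THEOREMS ONLY (no definition, no named fact, no instance,
no notation, no `sorry`). BSD is not proved by any of this; RSL_g is not proved here.

WHY. The S4₀ text `stub_deepHalfAwayTwo` (v3a) tests a character `χ : PAway` against `s ∈ selRelSubgroup` with the guard `locKer … π.v s = 0`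
through `∑ w, ∑ᶠ c, χ w c (locAway s w c)`; the socket `DeepHalfAssemblyAway.exists_iwasawaH1_prescribed_of_levelwise_orthogonal` (p697362)
tests LAYER classes `b ∈ H¹(Γ_n, A_ρ[2^k])` with the local conditions in Shapiro currency, and w2's
`CofreeSelmerTransfer.transferH1_mem_relaxed_strict_of_shapiroLift` (p692705) turns such a `b` into the transferred class
`τ b := res_{Γ_∞ ≤ Γ_n}((A_ρ[2^k] ↪ A_ρ)_* b)` lying in `{unramifiedOutside ∧ ∀ w σ infKer ∧ ∀ v ∣ 2, ∀ σ awayKer}`. To run the S4₀ hypothesis on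
`s := τ b` one needs `τ b` READ IN THE FRAME:

* §1 **`locKer_eq_zero_of_mem_awayKer`** — `s ∈ awayKer Γ_∞ A_ρ w ⟹ locKer w s = 0` (the guard `loc₂ s = 0` from the `awayKer` conjunct; a
  representative vanishing on `Γ_∞ ∩ D_w`, `exists_rep_vanishing_of_resOfLe_inf_eq_zero`, pulls back to the zero cocycle on `U_{∞,w}`).
* §2 **`conjH1_eq_conjMap`** — the two dialects of conjugation on `H¹(Γ_n, A_ρ[N])` agree (GV `conjH1` = Kato `conjMap … 1`).
* §3 **`locKer_transferH1`** — `locKer w (τ b) = jAway w n k (layerLocOf b)`; with §2 and `conjH1_resOfLe`/`conjH1_pushH1`: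
  **`locAway_transferH1`** — `locAway (τ b) w c = jAway w n k (layerLocOf (conj_{c.out} b))`, the term the S4₀ hypothesis evaluates.

References: [SerreGaloisCohomology1997] I §2.4–2.6; [NeukirchSchmidtWingberg2008] I §5; [Greenberg1989] §1 p. 98 (3); [GreenbergVatsal2000] §2;
[Kobayashi2003] (8.23).
-/

set_option autoImplicit false
-- the Theorems namespace of this sub repeats the summit name by design (D-0017 nested layout)
set_option linter.dupNamespace false

noncomputable section

open scoped Classical

namespace Summit.BirchSwinnertonDyer.BirchSwinnertonDyer.Theorems

namespace ThetaTransport.AwayLocKerTransfer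

open CategoryTheory Function Field NumberField IsDedekindDomain
  Literature.NumberTheory.EllipticCurves Literature.NumberTheory.EllipticCurves.CyclotomicLayer
  Literature.NumberTheory.EllipticCurves.GreenbergSelmer Literature.NumberTheory.EllipticCurves.GreenbergVatsal2000
  Literature.NumberTheory.GaloisRepresentations ZpExtension
  Summit.BirchSwinnertonDyer.BirchSwinnertonDyer.Theorems.OnePair

variable (S : Set (PadicAlgCl 2)) (κ : ZpExtension ℚ 2) (ρ : FramedGaloisRep ℚ ↥(padicCoeffIntegers S) 2)

/-! ## §1 The guard: `awayKer` membership gives `locKer = 0` -/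

/-- **`s ∈ awayKer Γ_∞ A_ρ w ⟹ locKer w s = 0`**: a class dying on `Γ_∞ ∩ D_w` has a representative cocycle VANISHING there (stabilisers of
`A_ρ` are open), and the frame's `locKer w` is the class of that cocycle pulled back along `U_{∞,w} → Γ_∞`, whose image lies in `Γ_∞ ∩ D_w`
(`D_w` = the image of `Γ_{ℚ_w}`). This is how the `awayKer` conjunct of `transferH1_mem_relaxed_strict_of_shapiroLift` discharges the S4₀
guard `locKer … π.v s = 0`. [cite: SerreGaloisCohomology1997, I §2.6 (b)] [cite: Greenberg1989, §1 p. 98 (3)] -/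
theorem locKer_eq_zero_of_mem_awayKer (w : HeightOneSpectrum (𝓞 ℚ))
    {s : subgroupH1 κ.kerSubgroup (Cofree ρ ↥(padicCoeffField S))}
    (hs : s ∈ awayKer κ.kerSubgroup (Cofree ρ ↥(padicCoeffField S)) w) : locKer S κ ρ w s = 0 := by
  rw [GreenbergSelmer.awayKer, AddMonoidHom.mem_ker] at hs
  obtain ⟨ψ, hψ, h0⟩ := CofreeSelmerTransfer.exists_rep_vanishing_of_resOfLe_inf_eq_zero κ.kerSubgroup (GreenbergSelmer.decomp w)
    (isOpen_stabilizer_cofree S ρ) hs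
  rw [← hψ, locKer_oneCocycleClass]
  have hc : contOneCocycles.pullback (resGalSubgroupOfEmb κ.kerSubgroup (closureEmb (K := ℚ) (w.adicCompletion ℚ)))
      (X := subgroupRep (cofreeGaloisModule S ρ).toTopRep κ.kerSubgroup) (Y := subgroupRep (localRepOf (cofreeGaloisModule S ρ) w) (kerGroup κ w))
      (TopRep.ofHom ⟨ContinuousLinearMap.id ℤ (Cofree ρ ↥(padicCoeffField S)), fun _ ↦ rfl⟩) ψ = 0 := by
    refine Subtype.ext (ContinuousMap.ext fun τ ↦ ?_)
    change ψ.1 (resGalSubgroupOfEmb κ.kerSubgroup (closureEmb (K := ℚ) (w.adicCompletion ℚ)) τ) = 0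
    exact h0 _ ⟨(τ : absoluteGaloisGroup (w.adicCompletion ℚ)), rfl⟩
  rw [hc]
  exact oneCocycleClass_zero _

/-! ## §2 The two dialects of conjugation on a layer agree -/

/-- **GV's `conjH1` IS Kato's `conjMap … 1`** on `H¹(Γ_n, A_ρ[N])` (both are `H¹` of the compatible pair `(h ↦ σ⁻¹hσ, a ↦ σ • a)`; checked on
cocycles). [cite: NeukirchSchmidtWingberg2008, I §5] -/
theorem conjH1_eq_conjMap (N : ℤ) (U : Subgroup (absoluteGaloisGroup ℚ)) [U.Normal] (σ : absoluteGaloisGroup ℚ)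
    (b : H1 (cofreeTorsionGaloisModule S ρ N) U) :
    conjH1 U ↥(AddSubgroup.torsionBy (Cofree ρ ↥(padicCoeffField S)) N) σ b = conjMap (cofreeTorsionGaloisModule S ρ N).toTopRep U σ 1 b := by
  obtain ⟨φ, rfl⟩ := oneCocycleClass_surjective _ b
  rw [conjMap_oneCocycleClass]
  exact (map_oneCocycleClass _ _ _ φ).trans (congrArg _ (Subtype.ext (ContinuousMap.ext fun _ ↦ rfl)))

/-! ## §3 The transferred class read through `locKer` and `locAway` -/

/-- **`locKer w (τ_{n,k} b) = j_{n,k}(loc_n b)`** for `b ∈ H¹(Γ_n, A_ρ[2^k])` and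
`τ b = res_{Γ_∞ ≤ Γ_n}((A_ρ[2^k] ↪ A_ρ)_* b)` (the transfer of `CofreeSelmerTransfer`, written VERBATIM): both sides are the class of the cocycle
`τ ↦ ↑(b(res τ))` on `U_{∞,w}`. [cite: SerreGaloisCohomology1997, I §2.4–2.5] [cite: Kobayashi2003, (8.23) (p. 18)] -/
theorem locKer_transferH1 (w : HeightOneSpectrum (𝓞 ℚ)) (n k : ℕ)
    (b : H1 (cofreeTorsionGaloisModule S ρ ((2 ^ k : ℕ) : ℤ)) (κ.layerSubgroup n)) :
    locKer S κ ρ w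
        (resOfLe (Cofree ρ ↥(padicCoeffField S)) (κ.kerSubgroup_le_layerSubgroup n)
          (pushH1 (κ.layerSubgroup n) (AddSubgroup.torsionBy (Cofree ρ ↥(padicCoeffField S)) ((2 ^ k : ℕ) : ℤ)).subtype
            (CofreeSelmerTransfer.torsionBy_subtype_smul S ρ ((2 ^ k : ℕ) : ℤ)) b)) =
      jAway S κ ρ w n k (layerLocOf (cofreeTorsionGaloisModule S ρ ((2 ^ k : ℕ) : ℤ)) κ w n b) := by
  obtain ⟨φ, rfl⟩ := oneCocycleClass_surjective _ b
  -- GV side: `pushH1` then `resOfLe` on the cocycle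
  erw [show pushH1 (κ.layerSubgroup n) (AddSubgroup.torsionBy (Cofree ρ ↥(padicCoeffField S)) ((2 ^ k : ℕ) : ℤ)).subtype
      (CofreeSelmerTransfer.torsionBy_subtype_smul S ρ ((2 ^ k : ℕ) : ℤ))
      (oneCocycleClass (subgroupRep (cofreeTorsionGaloisModule S ρ ((2 ^ k : ℕ) : ℤ)).toTopRep (κ.layerSubgroup n)) φ) = _
    from map_oneCocycleClass _ _ _ φ]
  erw [show resOfLe (Cofree ρ ↥(padicCoeffField S)) (κ.kerSubgroup_le_layerSubgroup n) (oneCocycleClass _ _) = _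
    from map_oneCocycleClass _ _ _ _]
  erw [locKer_oneCocycleClass]
  -- Kato side
  rw [layerLocOf_oneCocycleClass, jAway_apply, resLe_oneCocycleClass, cohomologyMap_oneCocycleClass]
  exact congrArg _ (Subtype.ext (ContinuousMap.ext fun _ ↦ rfl))

/-- **`locAway (τ_{n,k} b) w c = j_{n,k}(loc_n(c.out · b))`** — the `(w, c)`-term of the S4₀ hypothesis evaluated on a transferred test class
(`locAway_eq`, `conjH1_resOfLe`, `conjH1_pushH1`, §2, `locKer_transferH1`). [cite: GreenbergVatsal2000, §2] [cite: NeukirchSchmidtWingberg2008, I §5] -/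
theorem locAway_transferH1 (S₀ : Finset (HeightOneSpectrum (𝓞 ℚ))) (w : ↥S₀) (c : Cosets κ (w : HeightOneSpectrum (𝓞 ℚ))) (n k : ℕ)
    (b : H1 (cofreeTorsionGaloisModule S ρ ((2 ^ k : ℕ) : ℤ)) (κ.layerSubgroup n)) :
    locAway S κ ρ S₀
        (resOfLe (Cofree ρ ↥(padicCoeffField S)) (κ.kerSubgroup_le_layerSubgroup n)
          (pushH1 (κ.layerSubgroup n) (AddSubgroup.torsionBy (Cofree ρ ↥(padicCoeffField S)) ((2 ^ k : ℕ) : ℤ)).subtype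
            (CofreeSelmerTransfer.torsionBy_subtype_smul S ρ ((2 ^ k : ℕ) : ℤ)) b)) w c =
      jAway S κ ρ w n k (layerLocOf (cofreeTorsionGaloisModule S ρ ((2 ^ k : ℕ) : ℤ)) κ w n
        (conjMap (cofreeTorsionGaloisModule S ρ ((2 ^ k : ℕ) : ℤ)).toTopRep (κ.layerSubgroup n) c.out 1 b)) := by
  rw [locAway_eq, CofreeSelmerTransfer.conjH1_resOfLe, ThetaTransport.conjH1_pushH1, conjH1_eq_conjMap]
  exact locKer_transferH1 S κ ρ w n k _

end ThetaTransport.AwayLocKerTransfer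

end Summit.BirchSwinnertonDyer.BirchSwinnertonDyer.Theorems

end
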